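import Literature.Topology.FourManifolds.EuclideanIsotopyExtension
import HarnessLib

/-!
# Isotopy extension in `ℝᵏ⁺¹`, ambient-isotopy form (the whole conjugated family)

Topic `Literature/Topology/FourManifolds` (programme of the fact
`Literature.Topology.FourManifolds.cerf_pi0DiffDisc_relBoundary_three`, brick C3a).  `EuclideanIsotopyExtension.lean` transports a smooth
isotopy `F` of a compact boundaryless manifold `M` in `ℝᵏ⁺¹` into the sphere `Sᵏ⁺¹` by the
inverse stereographic parametrisation `ι`, extends it there to an ambient isotopy `Ψ` fixing the
missing point (the tree's `exists_ambientIsotopy_comp_eq_of_subset`, Milnor 1965, Thm. 5.8 /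
Hirsch Ch. 8, Thm. 1.3), and conjugates the END `Ψ₁` back to a diffeomorphism `θ` of `ℝᵏ⁺¹`
with `θ ∘ f = g`.  This file conjugates the WHOLE family: there is an ambient isotopy `Θ` of
`ℝᵏ⁺¹` (the tree's `AmbientIsotopy`: jointly smooth family of bijective local diffeomorphisms
from the identity) with `Θ_t ∘ f = F_t` for every `t ∈ [0, 1]`
(`exists_ambientIsotopy_comp_eq_euclidean`) — the form in which an isotopy of a curve or a
surface in `ℝ²`, `ℝ³` is realised by an ambient family of diffeomorphisms of the whole space
(used to move the unit circle inside the plane by a given circle diffeotopy while keeping the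
unit disc invariant, `C3a`).

## References
* [HirschDT1976] M. W. Hirsch, *Differential Topology*, GTM 33 (1976), Ch. 8 §1, Thm. 1.3.
* [MilnorHCobordism1965] J. Milnor, *Lectures on the h-cobordism theorem* (1965), Thm. 5.8.
-/

open Set Function Metric Module
open scoped Manifold ContDiff Topology

noncomputable section

namespace Literature.Topology.FourManifolds

variable {k : ℕ}

section Extension

variable {EM : Type*} [NormedAddCommGroup EM] [NormedSpace ℝ EM] [FiniteDimensional ℝ EM]
  {HM : Type*} [TopologicalSpace HM] {I : ModelWithCorners ℝ EM HM} [I.Boundaryless]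
  {M : Type*} [TopologicalSpace M] [ChartedSpace HM M] [IsManifold I ∞ M] [CompactSpace M]

open scoped EuclideanSpace in
/-- **Isotopy extension in `ℝᵏ⁺¹`, ambient-isotopy form.**  If `F` is a smooth isotopy of maps
`M → ℝᵏ⁺¹` of a compact boundaryless manifold `M` from `f` to `g`, there is an ambient isotopy
`Θ` of `ℝᵏ⁺¹` with `Θ_t ∘ f = F_t` for all `t ∈ [0, 1]` (conjugate by the stereographic chart
the ambient isotopy of the sphere extending the transported isotopy; every stage of the latter
fixes the missing point, so the conjugated stages are bijective local diffeomorphisms of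
`ℝᵏ⁺¹`, jointly smooth in `(t, y)`).
[cite: HirschDT1976, Ch. 8 §1, Thm. 1.3] [cite: MilnorHCobordism1965, Thm. 5.8] -/
theorem exists_ambientIsotopy_comp_eq_euclidean
    {f g : M → EuclideanSpace ℝ (Fin (k + 1))} (F : SmoothIsotopy I (𝓡 (k + 1)) f g) :
    ∃ Θ : AmbientIsotopy (𝓡 (k + 1)) (EuclideanSpace ℝ (Fin (k + 1))),
      ∀ t ∈ Icc (0 : ℝ) 1, Θ.toFun t ∘ f = F.toFun t := by
  haveI : CompleteSpace EM := FiniteDimensional.complete ℝ EM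
  set c := polarStereoChart k with hc
  -- extend the transported isotopy inside the chart domain of the sphere
  obtain ⟨Ψ, hΨ, hfix⟩ := exists_ambientIsotopy_comp_eq_of_subset F.stereo c.open_source
    (fun t x => polarStereoChart_symm_mem_source (F.toFun t x))
  -- every stage and inverse stage preserves the chart domain (they fix its complement)
  have hψfix : ∀ t y, y ∉ c.source → Ψ.toDiffeomorph t y = y := fun t y hy => hfix t y hy
  have hψsrc : ∀ t y, y ∈ c.source → Ψ.toDiffeomorph t y ∈ c.source := by
    intro t y hy
    by_contra h
    have h1 : Ψ.toDiffeomorph t y = y := (Ψ.toDiffeomorph t).injective (hψfix t _ h)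
    rw [h1] at h
    exact h hy
  have hψsrc' : ∀ t y, y ∈ c.source → (Ψ.toDiffeomorph t).symm y ∈ c.source := by
    intro t y hy
    by_contra h
    have h1 : Ψ.toDiffeomorph t ((Ψ.toDiffeomorph t).symm y) = (Ψ.toDiffeomorph t).symm y :=
      hψfix t _ h
    rw [Diffeomorph.apply_symm_apply] at h1
    rw [← h1] at h
    exact h hy
  -- the conjugated stages and inverse stages
  set θf : ℝ → EuclideanSpace ℝ (Fin (k + 1)) → EuclideanSpace ℝ (Fin (k + 1)) :=
    fun t y => c (Ψ.toDiffeomorph t (c.symm y)) with hθf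
  set θi : ℝ → EuclideanSpace ℝ (Fin (k + 1)) → EuclideanSpace ℝ (Fin (k + 1)) :=
    fun t y => c ((Ψ.toDiffeomorph t).symm (c.symm y)) with hθi
  have hleft : ∀ t y, θi t (θf t y) = y := by
    intro t y
    simp only [hθf, hθi]
    rw [c.left_inv (hψsrc t _ (polarStereoChart_symm_mem_source y)), Diffeomorph.symm_apply_apply,
      polarStereoChart_apply_symm]
  have hright : ∀ t y, θf t (θi t y) = y := by
    intro t y
    simp only [hθf, hθi]
    rw [c.left_inv (hψsrc' t _ (polarStereoChart_symm_mem_source y)), Diffeomorph.apply_symm_apply,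
      polarStereoChart_apply_symm]
  have hθf_smooth : ∀ t, ContMDiff (𝓡 (k + 1)) (𝓡 (k + 1)) ∞ (θf t) := fun t =>
    contMDiffOn_polarStereoChart.comp_contMDiff
      ((Ψ.toDiffeomorph t).contMDiff.comp contMDiff_polarStereoChart_symm)
      fun y => hψsrc t _ (polarStereoChart_symm_mem_source y)
  have hθi_smooth : ∀ t, ContMDiff (𝓡 (k + 1)) (𝓡 (k + 1)) ∞ (θi t) := fun t =>
    contMDiffOn_polarStereoChart.comp_contMDiff
      ((Ψ.toDiffeomorph t).symm.contMDiff.comp contMDiff_polarStereoChart_symm)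
      fun y => hψsrc' t _ (polarStereoChart_symm_mem_source y)
  -- the stage diffeomorphisms
  have θdiff : ∀ t, ∃ θ : EuclideanSpace ℝ (Fin (k + 1)) ≃ₘ⟮𝓡 (k + 1), 𝓡 (k + 1)⟯
      EuclideanSpace ℝ (Fin (k + 1)), ⇑θ = θf t := fun t =>
    ⟨⟨⟨θf t, θi t, hleft t, hright t⟩, hθf_smooth t, hθi_smooth t⟩, rfl⟩
  -- joint smoothness of the conjugated family
  have hjoint : ContMDiff (𝓘(ℝ, ℝ).prod (𝓡 (k + 1))) (𝓡 (k + 1)) ∞ (uncurry θf) := by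
    have h1 : ContMDiff (𝓘(ℝ, ℝ).prod (𝓡 (k + 1))) (𝓘(ℝ, ℝ).prod (𝓡 (k + 1))) ∞
        (fun q : ℝ × EuclideanSpace ℝ (Fin (k + 1)) => (q.1, c.symm q.2)) :=
      contMDiff_fst.prodMk (contMDiff_polarStereoChart_symm.comp contMDiff_snd)
    have h2 : ContMDiff (𝓘(ℝ, ℝ).prod (𝓡 (k + 1))) (𝓡 (k + 1)) ∞
        (fun q : ℝ × EuclideanSpace ℝ (Fin (k + 1)) => Ψ.toFun q.1 (c.symm q.2)) :=
      Ψ.contMDiff.comp h1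
    refine contMDiffOn_polarStereoChart.comp_contMDiff h2 fun q => ?_
    exact hψsrc q.1 _ (polarStereoChart_symm_mem_source q.2)
  refine ⟨{ toFun := θf
            contMDiff := hjoint
            bijective := fun t => ⟨fun x y hxy => by
                have := congrArg (θi t) hxy; rwa [hleft, hleft] at this,
              fun y => ⟨θi t y, hright t y⟩⟩
            isLocalDiffeomorph := fun t => by
              obtain ⟨θ, hθ⟩ := θdiff t
              rw [← hθ]; exact θ.isLocalDiffeomorph
            map_zero := by
              funext y
              simp only [hθf, AmbientIsotopy.coe_toDiffeomorph, Ψ.map_zero, id_eq]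
              exact polarStereoChart_apply_symm y }, fun t ht => funext fun x => ?_⟩
  -- `Θ_t (f x) = c (Ψ_t (ι (f x))) = c (ι (F_t x)) = F_t x`
  show c (Ψ.toDiffeomorph t (c.symm (f x))) = F.toFun t x
  have h1 : Ψ.toFun t ((polarStereoChart k).symm (f x)) = (polarStereoChart k).symm (F.toFun t x) :=
    congrFun (hΨ t ht) x
  rw [AmbientIsotopy.coe_toDiffeomorph, ← hc] at *
  rw [h1, polarStereoChart_apply_symm]

end Extension

end Literature.Topology.FourManifolds

end
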